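import Mathlib.Algebra.DualNumber
import Mathlib.RingTheory.Nakayama
import Mathlib.RingTheory.LocalRing.ResidueField.Basic
import Mathlib.LinearAlgebra.Dual.Lemmas
import HarnessLib

/-!
# Tangent vectors detect the maximal ideal: if no non-zero `k`-algebra map `R → k[ε]` kills `I`, then `𝔪 ≤ I`
# ([Hartshorne1977] II Ex. 2.8: `k[ε]`-points = rational point + element of `Hom_k(𝔪/𝔪², k)`; Nakayama)

Layer `Literature/Algebra/Module`, namespace `Literature.Algebra.Module`.  THEOREMS ONLY (no definition, no named fact, no instance, no
notation, no `sorry`), Mathlib only.  Cell `hodgecm-mathlib` (D-0151), brick B5(c-alg) of the «H1-DIM-ANY-CHAR cut» (B-p04 memo v2 §1): the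
PURE ALGEBRA under [MumfordAV1970] §13 (proof of the Theorem, pp. 127–129) «the module `Q` representing `B ↦ H⁰(X × Spec B, P_B)` is `k`,
because a non-trivial quotient would give a non-constant `k[ε]`-point of `X̂` over which `P` is trivial».

Setting: `k` a field, `R` a commutative `k`-algebra with a `k`-RATIONAL POINT `res : R →ₐ[k] k` (for `R` local this forces `ker res = 𝔪`), and
`k[ε] = DualNumber k`.  A `k`-algebra map `τ : R →ₐ[k] k[ε]` is «the point `res` plus a tangent vector»; it is TANGENTIALLY ZERO when
`snd ∘ τ` vanishes on `ker res` (equivalently `τ = inl ∘ res`).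

* §1 `exists_algHom_dualNumber_of_linearMap` — every `k`-linear `ℓ : R → k` with `ℓ 1 = 0` and `ℓ (x y) = 0` for `x, y ∈ ker res` is the
  `ε`-part of a `k`-algebra map `τ_ℓ = inl ∘ res + inr ∘ ℓ : R → k[ε]` ([Hartshorne1977] II Ex. 2.8; [GortzWedhorn2020] (6.4)).
* §2 `ker_algHom_eq_maximalIdeal` — for `R` local, every `k`-algebra map `R →ₐ[k] k` has kernel `𝔪` (it is onto a field).
* §3 **`maximalIdeal_le_of_forall_algHom_dualNumber`** — `R` local with `𝔪` finitely generated, `I` an ideal: if EVERY `τ : R →ₐ[k] k[ε]`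
  with `τ(I) = 0` is tangentially zero, then `𝔪 ≤ I` (hence `I = 𝔪` when `I ≤ 𝔪`, `maximalIdeal_eq_of_forall_algHom_dualNumber`).  Proof: if
  `m₀ ∈ 𝔪 ∖ (I + 𝔪²)` a `k`-linear functional `ℓ` on `R` vanishing on `I + 𝔪² + k·1` with `ℓ(m₀) ≠ 0` exists (duals separate points modulo a
  subspace, Mathlib `Submodule.exists_dual_map_eq_bot_of_notMem`); `τ_ℓ` (§1) kills `I` but `snd (τ_ℓ m₀) = ℓ m₀ ≠ 0`; so `𝔪 ≤ I + 𝔪·𝔪`, and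
  Nakayama (Mathlib `Submodule.le_of_le_smul_of_le_jacobson_bot`) gives `𝔪 ≤ I`.
* §4 **`nonempty_linearEquiv_residueField_of_forall_algHom_dualNumber`** — module form: a CYCLIC `R`-module `Q = R·q₀ ≠ 0` such that every
  `τ : R →ₐ[k] k[ε]` killing `ann(q₀)` is tangentially zero is `≃ₗ[R] ResidueField R` (the shape consumed by ★ B3
  `Algebra/Homology/BettiOneResidueField` through `ε : Dual R K⁰ ↠ k`).

HC_CM is proved only modulo the 7 printed citations until rung 0 closes; nothing here bears on a summit statement (count-neutral capital).

## References
* [Hartshorne1977] R. Hartshorne, *Algebraic Geometry* (1977), II Ex. 2.8 (p. 80) (the `k[ε]`-points of a `k`-scheme).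
* [GortzWedhorn2020] U. Görtz, T. Wedhorn, *Algebraic Geometry I*, 2nd ed. (2020), (6.4) and Prop. 6.7 (p. 152) (tangent vectors as `k[ε]`-points).
* [AtiyahMacdonald1969] M. F. Atiyah, I. G. Macdonald, *Introduction to Commutative Algebra* (1969), Prop. 2.6 and Cor. 2.7 (p. 21) (Nakayama).
* [MumfordAV1970] D. Mumford, *Abelian Varieties* (1970), §13, proof of the Theorem (pp. 127–129).
-/

set_option autoImplicit false

universe u v

open TrivSqZeroExt IsLocalRing

namespace Literature.Algebra.Module

/-! ## §1 The `k[ε]`-point attached to a functional -/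

section Point

variable {k : Type u} {R : Type v} [Field k] [CommRing R] [Algebra k R] (res : R →ₐ[k] k)

/-- `r - res(r)·1` lies in the kernel of the rational point `res`. [cite: Hartshorne1977, II Ex. 2.8 (p. 80)] -/
theorem res_sub_algebraMap_res (r : R) : res (r - algebraMap k R (res r)) = 0 := by
  rw [map_sub, AlgHom.commutes, Algebra.algebraMap_self_apply, sub_self]

/-- **Leibniz rule from the two vanishing conditions**: a `k`-linear `ℓ : R → k` with `ℓ 1 = 0` and `ℓ (x y) = 0` for all `x, y ∈ ker res`
satisfies `ℓ (r s) = res r · ℓ s + ℓ r · res s` (expand `r = res(r)·1 + x`, `s = res(s)·1 + y`).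
[cite: Hartshorne1977, II Ex. 2.8 (p. 80)] [cite: GortzWedhorn2020, (6.4) and Prop. 6.7 (p. 152)] -/
theorem leibniz_of_linearMap (ℓ : R →ₗ[k] k) (h1 : ℓ 1 = 0) (hmul : ∀ x y : R, res x = 0 → res y = 0 → ℓ (x * y) = 0) (r s : R) :
    ℓ (r * s) = res r * ℓ s + ℓ r * res s := by
  set a := res r with ha
  set b := res s with hb
  set x := r - algebraMap k R a with hx
  set y := s - algebraMap k R b with hy
  have hxr : res x = 0 := res_sub_algebraMap_res res r
  have hys : res y = 0 := res_sub_algebraMap_res res s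
  have hr : r = algebraMap k R a + x := by rw [hx]; abel
  have hs : s = algebraMap k R b + y := by rw [hy]; abel
  have hℓa : ∀ (c : k) (t : R), ℓ (algebraMap k R c * t) = c * ℓ t := fun c t => by
    rw [← Algebra.smul_def, map_smul, smul_eq_mul]
  have hℓa' : ∀ (c : k) (t : R), ℓ (t * algebraMap k R c) = c * ℓ t := fun c t => by
    rw [mul_comm, hℓa]
  have hℓc : ∀ c : k, ℓ (algebraMap k R c) = 0 := fun c => by
    rw [Algebra.algebraMap_eq_smul_one, map_smul, h1, smul_zero]
  have hℓx : ℓ x = ℓ r := by rw [hx, map_sub, hℓc, sub_zero]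
  have hℓy : ℓ y = ℓ s := by rw [hy, map_sub, hℓc, sub_zero]
  calc ℓ (r * s) = ℓ ((algebraMap k R a + x) * (algebraMap k R b + y)) := by rw [← hr, ← hs]
    _ = ℓ (algebraMap k R a * algebraMap k R b) + ℓ (algebraMap k R a * y) + ℓ (x * algebraMap k R b) + ℓ (x * y) := by
        rw [add_mul, mul_add, mul_add, map_add, map_add, map_add]; abel
    _ = a * ℓ s + ℓ r * b := by
        rw [hmul x y hxr hys, ← map_mul, hℓc, hℓa, hℓa', hℓx, hℓy, zero_add, add_zero, mul_comm b]

/-- **The `k[ε]`-point `τ_ℓ = res + ℓ·ε`** ([Hartshorne1977] II Ex. 2.8: a `k`-morphism `Spec k[ε] → X` is a rational point `x` together with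
an element of `Hom_k(𝔪_x/𝔪_x², k)`): for `ℓ : R →ₗ[k] k` with `ℓ 1 = 0` and `ℓ (x y) = 0` on `ker res`, there is a `k`-algebra map
`τ : R →ₐ[k] k[ε]` with `fst (τ r) = res r` and `snd (τ r) = ℓ r`.
[cite: Hartshorne1977, II Ex. 2.8 (p. 80)] [cite: GortzWedhorn2020, (6.4) and Prop. 6.7 (p. 152)] -/
theorem exists_algHom_dualNumber_of_linearMap (ℓ : R →ₗ[k] k) (h1 : ℓ 1 = 0)
    (hmul : ∀ x y : R, res x = 0 → res y = 0 → ℓ (x * y) = 0) :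
    ∃ τ : R →ₐ[k] DualNumber k, ∀ r, fst (τ r) = res r ∧ snd (τ r) = ℓ r := by
  let f : R →ₗ[k] DualNumber k := (Algebra.linearMap k (DualNumber k)).comp res.toLinearMap + (inrHom k k).comp ℓ
  have hf : ∀ r, f r = inl (res r) + inr (ℓ r) := fun r => by
    change algebraMap k (DualNumber k) (res r) + inr (ℓ r) = _
    rw [algebraMap_eq_inl]
  have hfst : ∀ r, fst (f r) = res r := fun r => by rw [hf, fst_add, fst_inl, fst_inr, add_zero]
  have hsnd : ∀ r, snd (f r) = ℓ r := fun r => by rw [hf, snd_add, snd_inl, snd_inr, zero_add]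
  have hone : f 1 = 1 := by
    refine TrivSqZeroExt.ext ?_ ?_
    · rw [hfst, map_one, fst_one]
    · rw [hsnd, h1, snd_one]
  have hfmul : ∀ x y, f (x * y) = f x * f y := fun x y => by
    refine TrivSqZeroExt.ext ?_ ?_
    · rw [hfst, map_mul, fst_mul, hfst, hfst]
    · rw [hsnd, DualNumber.snd_mul, hfst, hfst, hsnd, hsnd, leibniz_of_linearMap res ℓ h1 hmul x y]
  exact ⟨AlgHom.ofLinearMap f hone hfmul, fun r => ⟨hfst r, hsnd r⟩⟩

/-- The first component of a `k`-algebra map `R → k[ε]` is a `k`-algebra map `R → k`. [cite: GortzWedhorn2020, (6.4) and Prop. 6.7 (p. 152)] -/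
theorem exists_algHom_fst_comp (τ : R →ₐ[k] DualNumber k) : ∃ ρ : R →ₐ[k] k, ∀ r, ρ r = fst (τ r) :=
  ⟨(fstHom k k k).comp τ, fun _ => rfl⟩

end Point

/-! ## §2 Rational points of a local `k`-algebra -/

section Local

variable {k : Type u} {R : Type v} [Field k] [CommRing R] [Algebra k R] [IsLocalRing R]

/-- **Every `k`-algebra map `R →ₐ[k] k` from a LOCAL `k`-algebra has kernel `𝔪`** (it is onto the field `k`, so its kernel is maximal).
[cite: Hartshorne1977, II Ex. 2.8 (p. 80)] [cite: AtiyahMacdonald1969, Prop. 1.2 and Cor. 1.3 (p. 3)] -/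
theorem ker_algHom_eq_maximalIdeal (res : R →ₐ[k] k) : RingHom.ker res = maximalIdeal R := by
  have hsurj : Function.Surjective res := fun c => ⟨algebraMap k R c, res.commutes c⟩
  exact IsLocalRing.eq_maximalIdeal (RingHom.ker_isMaximal_of_surjective res hsurj)

/-- For `R` local: `res r = 0 ↔ r ∈ 𝔪`. [cite: Hartshorne1977, II Ex. 2.8 (p. 80)] -/
theorem algHom_eq_zero_iff_mem_maximalIdeal (res : R →ₐ[k] k) (r : R) : res r = 0 ↔ r ∈ maximalIdeal R := by
  rw [← ker_algHom_eq_maximalIdeal res, RingHom.mem_ker]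

/-- For `R` local, the first component of every `τ : R →ₐ[k] k[ε]` vanishes exactly on `𝔪`. [cite: GortzWedhorn2020, (6.4) and Prop. 6.7 (p. 152)] -/
theorem fst_algHom_dualNumber_eq_zero_iff (τ : R →ₐ[k] DualNumber k) (r : R) : fst (τ r) = 0 ↔ r ∈ maximalIdeal R := by
  obtain ⟨ρ, hρ⟩ := exists_algHom_fst_comp τ
  rw [← hρ, algHom_eq_zero_iff_mem_maximalIdeal ρ]

/-! ## §3 The tangent space detects `𝔪` modulo `I` -/

/-- **TANGENT VECTORS DETECT THE MAXIMAL IDEAL.**  `R` a local `k`-algebra with a rational point `res : R →ₐ[k] k` and `𝔪` finitely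
generated, `I` an ideal.  If every `k`-algebra map `τ : R → k[ε]` with `τ(I) = 0` is tangentially zero (`snd (τ r) = 0` for all `r ∈ 𝔪`),
then `𝔪 ≤ I`.  (If `m₀ ∈ 𝔪 ∖ (I + 𝔪²)`, a functional `ℓ` vanishing on `I + 𝔪² + k·1` with `ℓ m₀ ≠ 0` gives the point `τ_ℓ` of §1 killing `I`
with `snd (τ_ℓ m₀) ≠ 0`; so `𝔪 ≤ I + 𝔪·𝔪`, and Nakayama.)
[cite: Hartshorne1977, II Ex. 2.8 (p. 80)] [cite: AtiyahMacdonald1969, Prop. 2.6 and Cor. 2.7 (p. 21)] [cite: MumfordAV1970, §13 (proof of the Theorem, pp. 127–129)] -/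
theorem maximalIdeal_le_of_forall_algHom_dualNumber (res : R →ₐ[k] k) (hfg : (maximalIdeal R).FG) (I : Ideal R)
    (H : ∀ τ : R →ₐ[k] DualNumber k, (∀ r ∈ I, τ r = 0) → ∀ r ∈ maximalIdeal R, snd (τ r) = 0) :
    maximalIdeal R ≤ I := by
  classical
  -- WLOG `I ≤ 𝔪`
  by_cases hI : I ≤ maximalIdeal R
  swap
  · have hI' : I = ⊤ := by
      by_contra hne
      exact hI (IsLocalRing.le_maximalIdeal hne)
    rw [hI']
    exact le_top
  -- Nakayama: it suffices that `𝔪 ≤ I ⊔ 𝔪 • 𝔪`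
  refine Submodule.le_of_le_smul_of_le_jacobson_bot hfg (IsLocalRing.maximalIdeal_le_jacobson ⊥) fun m₀ hm₀ => ?_
  by_contra hnot
  -- the `k`-subspace `S = (I ⊔ 𝔪•𝔪) + k·1` of `R` does not contain `m₀`
  let S : Submodule k R := (I ⊔ maximalIdeal R • maximalIdeal R).restrictScalars k ⊔ k ∙ (1 : R)
  have hm₀S : m₀ ∉ S := by
    intro h
    obtain ⟨s, hs, t, ht, hst⟩ := Submodule.mem_sup.mp h
    obtain ⟨c, rfl⟩ := Submodule.mem_span_singleton.mp ht
    have hs' : s ∈ I ⊔ maximalIdeal R • maximalIdeal R := hs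
    -- `c • 1 = m₀ - s ∈ 𝔪`, so `c = 0`
    have hc1 : c • (1 : R) ∈ maximalIdeal R := by
      have : c • (1 : R) = m₀ - s := by rw [← hst]; abel
      rw [this]
      refine Submodule.sub_mem _ hm₀ ?_
      exact (sup_le hI Submodule.smul_le_right) hs'
    have hc : c = 0 := by
      by_contra hc
      have hu : IsUnit (c • (1 : R)) := by
        rw [Algebra.smul_def, mul_one]
        exact (IsUnit.mk0 c hc).map (algebraMap k R)
      exact (IsLocalRing.mem_maximalIdeal _).mp hc1 hu
    rw [hc, zero_smul, add_zero] at hst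
    exact hnot (hst ▸ hs')
  -- a functional vanishing on `S` and not on `m₀`
  haveI : Module.Projective k (R ⧸ S) := Module.Projective.of_free
  obtain ⟨ℓ, hℓm₀, hℓS⟩ := Submodule.exists_dual_map_eq_bot_of_notMem hm₀S inferInstance
  have hℓS' : ∀ s ∈ S, ℓ s = 0 := fun s hs => by
    have : ℓ s ∈ S.map ℓ := Submodule.mem_map_of_mem hs
    rwa [hℓS, Submodule.mem_bot] at this
  have h1 : ℓ 1 = 0 := hℓS' 1 (Submodule.mem_sup_right (Submodule.mem_span_singleton_self _))
  have hmul : ∀ x y : R, res x = 0 → res y = 0 → ℓ (x * y) = 0 := fun x y hx hy => by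
    refine hℓS' _ (Submodule.mem_sup_left ?_)
    change x * y ∈ I ⊔ maximalIdeal R • maximalIdeal R
    refine Submodule.mem_sup_right (Submodule.smul_mem_smul ?_ ?_)
    · exact (algHom_eq_zero_iff_mem_maximalIdeal res x).mp hx
    · exact (algHom_eq_zero_iff_mem_maximalIdeal res y).mp hy
  -- the point `τ_ℓ` kills `I` but is not tangentially zero
  obtain ⟨τ, hτ⟩ := exists_algHom_dualNumber_of_linearMap res ℓ h1 hmul
  have hτI : ∀ r ∈ I, τ r = 0 := fun r hr => by
    refine TrivSqZeroExt.ext ?_ ?_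
    · rw [(hτ r).1, fst_zero]
      exact (algHom_eq_zero_iff_mem_maximalIdeal res r).mpr (hI hr)
    · rw [(hτ r).2, snd_zero]
      exact hℓS' r (Submodule.mem_sup_left (show r ∈ I ⊔ maximalIdeal R • maximalIdeal R from Submodule.mem_sup_left hr))
  have := H τ hτI m₀ hm₀
  rw [(hτ m₀).2] at this
  exact hℓm₀ this

/-- **`I = 𝔪`** under the same hypothesis when `I ≤ 𝔪`. [cite: Hartshorne1977, II Ex. 2.8 (p. 80)] [cite: AtiyahMacdonald1969, Prop. 2.6 and Cor. 2.7 (p. 21)] -/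
theorem maximalIdeal_eq_of_forall_algHom_dualNumber (res : R →ₐ[k] k) (hfg : (maximalIdeal R).FG) (I : Ideal R)
    (hI : I ≤ maximalIdeal R)
    (H : ∀ τ : R →ₐ[k] DualNumber k, (∀ r ∈ I, τ r = 0) → ∀ r ∈ maximalIdeal R, snd (τ r) = 0) :
    I = maximalIdeal R :=
  le_antisymm hI (maximalIdeal_le_of_forall_algHom_dualNumber res hfg I H)

/-- The trivial converse: every `τ` killing `𝔪` is tangentially zero. [cite: GortzWedhorn2020, (6.4) and Prop. 6.7 (p. 152)] -/
theorem snd_algHom_dualNumber_eq_zero_of_forall_mem_maximalIdeal (τ : R →ₐ[k] DualNumber k)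
    (hτ : ∀ r ∈ maximalIdeal R, τ r = 0) (r : R) (hr : r ∈ maximalIdeal R) : snd (τ r) = 0 := by
  rw [hτ r hr, snd_zero]

/-! ## §4 Module form: a cyclic module detected by tangent vectors is the residue field -/

/-- **A CYCLIC MODULE WHOSE ANNIHILATOR IS DETECTED BY NO TANGENT VECTOR IS THE RESIDUE FIELD.**  `R` a local `k`-algebra with a rational
point and `𝔪` finitely generated, `Q = R·q₀` cyclic with `q₀ ≠ 0`; if every `τ : R →ₐ[k] k[ε]` killing `ann(q₀) = {r ; r·q₀ = 0}` is
tangentially zero, then `Q ≃ₗ[R] ResidueField R` (= `R/𝔪`).  This is the algebra of [MumfordAV1970] §13 pp. 127–129 (`Q` there represents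
`B ↦ H⁰(X × Spec B, P_B)`; the hypothesis is first-order rigidity of `P`).
[cite: MumfordAV1970, §13 (proof of the Theorem, pp. 127–129)] [cite: Hartshorne1977, II Ex. 2.8 (p. 80)] -/
theorem nonempty_linearEquiv_residueField_of_forall_algHom_dualNumber (res : R →ₐ[k] k) (hfg : (maximalIdeal R).FG)
    {Q : Type v} [AddCommGroup Q] [Module R Q] (q₀ : Q) (hq₀ : Submodule.span R {q₀} = ⊤) (hne : q₀ ≠ 0)
    (H : ∀ τ : R →ₐ[k] DualNumber k, (∀ r : R, r • q₀ = 0 → τ r = 0) → ∀ r ∈ maximalIdeal R, snd (τ r) = 0) :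
    Nonempty (Q ≃ₗ[R] ResidueField R) := by
  let π : R →ₗ[R] Q := LinearMap.toSpanSingleton R Q q₀
  have hπ : Function.Surjective π := by
    rw [← LinearMap.range_eq_top]
    change LinearMap.range (LinearMap.toSpanSingleton R Q q₀) = ⊤
    rw [LinearMap.range_toSpanSingleton, hq₀]
  let I : Ideal R := LinearMap.ker π
  have hIq : ∀ r : R, r ∈ I ↔ r • q₀ = 0 := fun r => LinearMap.mem_ker
  have hIle : I ≤ maximalIdeal R := by
    refine IsLocalRing.le_maximalIdeal fun htop => hne ?_
    have h1 : (1 : R) ∈ I := htop ▸ Submodule.mem_top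
    rw [hIq, one_smul] at h1
    exact h1
  have hIeq : I = maximalIdeal R :=
    maximalIdeal_eq_of_forall_algHom_dualNumber res hfg I hIle fun τ hτ => H τ fun r hr => hτ r ((hIq r).mpr hr)
  exact ⟨(LinearMap.quotKerEquivOfSurjective π hπ).symm ≪≫ₗ Submodule.quotEquivOfEq _ _ hIeq⟩

end Local

end Literature.Algebra.Module
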